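import Summits.QuantumFields.YangMills.Theorems.ColdStartUniversalityLatticeLangevinLawDensityBound
import Summits.QuantumFields.YangMills.Theorems.ColdStartUniversalityLatticeLangevinGroundStateComparisonExplicit
import Summits.QuantumFields.YangMills.Theorems.ColdStartUniversalityLatticeLangevinHeatKernelDominationExplicit
import HarnessLib

/-!
# Route `ColdStartUniversality` (fixed-cut-off package, explicit constants): the UNIFORM-IN-TIME DENSITY BOUND for the law of the
# SU(2) SZZ dynamics WITH AN EXPLICIT CONSTANT — `law(U_(t₁+s)) ≤ D · Haar^{⊗E}`, `log D = O(L³)` explicitly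

Helper file (seat `ym-line-csu-p1`, g27; `--supports stmt-QuantumFields-24809`).  g9's `map_le_smul_haar_of_le` (every solution from a
deterministic start, every `s ≥ 0`: `law(U_(t₁+s)) ≤ C·Haar^{⊗E}`) has `C = C(L, β', z, t₁)` by compactness only, whence the KL budget
`log D` of g26's `wilson_klDiv_map_le_log` and every cold-start mixing statement of the package carry an inexplicit burn-in constant.
Here every constant is explicit (`#E = #𝒫 = 3L³`):
* ★ `wilsonMeasure_le_smul_pi_haar_and_explicit` — `μ_(β') ≤ a·Haar^{⊗E}` and `Haar^{⊗E} ≤ a·μ_(β')` with `a = e^(4|β'|#𝒫)·e^(4|β'|#𝒫)`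
  (`0 ≤ S_W ≤ 4#𝒫`);
* ★★ `map_le_smul_haar_explicit` — at a lattice time `t ≥ 2`: `law(U_t) ≤ e^(48|β'|#E·t + 2|β'|#𝒫) · 2(3/2)^(#E) · Haar^{⊗E}`
  (`integral_le_exp_mul_integral_beta_zero_explicit` + `map_le_smul_haar_beta_zero_explicit`);
* ★★★ `map_le_smul_haar_of_le_explicit` — for `t₁ ≥ 2` and EVERY `s ≥ 0`:
  `law(U_(t₁+s)) ≤ D · Haar^{⊗E}`,  `D = e^(48|β'|#E·t₁ + 2|β'|#𝒫) · 2(3/2)^(#E) · a²`, so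
  `log D = (48 t₁ + 2 + 16)|β'|·3L³ + 3L³·log(3/2) + log 2` — LINEAR IN THE VOLUME.
Proofs: verbatim g9 with the explicit inputs.  THEOREMS ONLY, no definition, no sorry.  HONEST FRAMING: fixed-cut-off plumbing for the
RECORD rung (explicit burn-in of the cold start); nothing K-uniform; no crux, rung or summit statement is proved; the Yang–Mills mass gap
is NOT proved.
-/

set_option autoImplicit false

noncomputable section

namespace Summit.QuantumFields.YangMills.Theorems.ColdStartUniversality

open MeasureTheory ProbabilityTheory
open scoped NNReal ENNReal
open Literature.Probability.Process Literature.MathematicalPhysics.QuantumFieldTheory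
open Literature.MathematicalPhysics.QuantumLattice (fundamentalRep fundamentalLatticeRep continuous_fundamentalRep)

variable {L : ℕ} [NeZero L]

/-! ## §1 Product Haar and the Wilson measure, explicit constant -/

/-- ★ **Two-sided comparison of the Wilson measure with product Haar, explicit**: with `a = e^(4|β|#𝒫)·e^(4|β|#𝒫)`,
`μ_W ≤ a · Haar^{⊗E}` and `Haar^{⊗E} ≤ a · μ_W` (`0 ≤ S_W ≤ 4#𝒫` on `SU(2)^E`). [folklore] -/
theorem wilsonMeasure_le_smul_pi_haar_and_explicit (β : ℝ) :
    wilsonMeasure (d := 3) (L := L) (fundamentalRep (Fin 2)) β ≤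
        (ENNReal.ofReal (Real.exp (|β| * (4 * (Fintype.card (Plaquette 3 L) : ℝ))) * Real.exp (|β| * (4 * (Fintype.card (Plaquette 3 L) : ℝ))))) • (Measure.pi fun _ : Edge 3 L => haarProbability (Matrix.specialUnitaryGroup (Fin 2) ℂ)) ∧
      (Measure.pi fun _ : Edge 3 L => haarProbability (Matrix.specialUnitaryGroup (Fin 2) ℂ)) ≤
        (ENNReal.ofReal (Real.exp (|β| * (4 * (Fintype.card (Plaquette 3 L) : ℝ))) * Real.exp (|β| * (4 * (Fintype.card (Plaquette 3 L) : ℝ))))) • wilsonMeasure (d := 3) (L := L) (fundamentalRep (Fin 2)) β := by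
  haveI : IsProbabilityMeasure (haarProbability (Matrix.specialUnitaryGroup (Fin 2) ℂ)) := inferInstance
  set π : Measure (GaugeConfig 3 L (Matrix.specialUnitaryGroup (Fin 2) ℂ)) :=
    Measure.pi fun _ : Edge 3 L => haarProbability (Matrix.specialUnitaryGroup (Fin 2) ℂ) with hπ
  haveI : IsProbabilityMeasure π := by rw [hπ]; infer_instance
  obtain ⟨B, hBdef⟩ : ∃ B : ℝ, (4 * (Fintype.card (Plaquette 3 L) : ℝ)) = B := ⟨_, rfl⟩
  have hB : ∀ U : GaugeConfig 3 L (Matrix.specialUnitaryGroup (Fin 2) ℂ), |wilsonAction (fundamentalRep (Fin 2)) U| ≤ B := fun U => by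
    rw [← hBdef, abs_of_nonneg (wilsonAction_su2_nonneg (L := L) U)]
    exact wilsonAction_su2_le (L := L) U
  rw [hBdef]
  set w : GaugeConfig 3 L (Matrix.specialUnitaryGroup (Fin 2) ℂ) → ℝ≥0∞ :=
    fun U => ENNReal.ofReal (Real.exp (-β * wilsonAction (fundamentalRep (Fin 2)) U)) with hw
  set ep : ℝ := Real.exp (|β| * B) with hep
  set em : ℝ := Real.exp (-(|β| * B)) with hem
  have heppos : 0 < ep := Real.exp_pos _
  have hempos : 0 < em := Real.exp_pos _
  have hbound : ∀ U : GaugeConfig 3 L (Matrix.specialUnitaryGroup (Fin 2) ℂ), |β * wilsonAction (fundamentalRep (Fin 2)) U| ≤ |β| * B :=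
    fun U => by rw [abs_mul]; exact mul_le_mul_of_nonneg_left (hB U) (abs_nonneg _)
  have hw_le : ∀ U, w U ≤ ENNReal.ofReal ep := fun U => ENNReal.ofReal_le_ofReal (Real.exp_le_exp.2 (by
    have := (abs_le.1 (hbound U)).1; linarith))
  have hw_ge : ∀ U, ENNReal.ofReal em ≤ w U := fun U => ENNReal.ofReal_le_ofReal (Real.exp_le_exp.2 (by
    have := (abs_le.1 (hbound U)).2; linarith))
  -- the weight measure and the partition function
  have hW : wilsonWeight (d := 3) (L := L) (fundamentalRep (Fin 2)) β = π.withDensity w := rfl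
  set Z : ℝ≥0∞ := partitionFunction (d := 3) (L := L) (fundamentalRep (Fin 2)) β with hZdef
  have hZ : Z = ∫⁻ U, w U ∂π := by
    rw [hZdef, partitionFunction, hW, withDensity_apply _ MeasurableSet.univ, Measure.restrict_univ]
  have hZlow : ENNReal.ofReal em ≤ Z := by
    rw [hZ]
    calc ENNReal.ofReal em = ∫⁻ _U, ENNReal.ofReal em ∂π := by rw [lintegral_const, measure_univ, mul_one]
      _ ≤ _ := lintegral_mono fun U => hw_ge U
  have hZup : Z ≤ ENNReal.ofReal ep := by
    rw [hZ]
    calc _ ≤ ∫⁻ _U, ENNReal.ofReal ep ∂π := lintegral_mono fun U => hw_le U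
      _ = _ := by rw [lintegral_const, measure_univ, mul_one]
  have hZ0 : Z ≠ 0 := (lt_of_lt_of_le (ENNReal.ofReal_pos.2 hempos) hZlow).ne'
  have hZtop : Z ≠ ∞ := ne_top_of_le_ne_top ENNReal.ofReal_ne_top hZup
  have hμW : wilsonMeasure (d := 3) (L := L) (fundamentalRep (Fin 2)) β = Z⁻¹ • π.withDensity w := by
    rw [wilsonMeasure, hZdef, hW]
  -- the comparison constants in `ℝ≥0∞`
  have hinv_em : (ENNReal.ofReal em)⁻¹ = ENNReal.ofReal ep := by
    rw [← ENNReal.ofReal_inv_of_pos hempos, hem, hep, Real.exp_neg, inv_inv]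
  have hZinv_le : Z⁻¹ ≤ ENNReal.ofReal ep := by
    rw [← hinv_em]; exact ENNReal.inv_le_inv.2 hZlow
  refine ⟨?_, ?_⟩
  · -- `μ_W = Z⁻¹ • π.withDensity w ≤ Z⁻¹ ep • π ≤ ep² • π`
    rw [hμW, Measure.le_iff]
    intro s hs
    rw [Measure.smul_apply, Measure.smul_apply, smul_eq_mul, smul_eq_mul, withDensity_apply _ hs,
      ENNReal.ofReal_mul heppos.le]
    calc Z⁻¹ * ∫⁻ U in s, w U ∂π ≤ Z⁻¹ * ∫⁻ _U in s, ENNReal.ofReal ep ∂π :=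
          mul_le_mul' le_rfl (lintegral_mono fun U => hw_le U)
      _ = Z⁻¹ * (ENNReal.ofReal ep * π s) := by rw [lintegral_const, Measure.restrict_apply_univ]
      _ ≤ ENNReal.ofReal ep * (ENNReal.ofReal ep * π s) := mul_le_mul' hZinv_le le_rfl
      _ = ENNReal.ofReal ep * ENNReal.ofReal ep * π s := (mul_assoc _ _ _).symm
  · -- `π ≤ ep • π.withDensity w = ep Z • μ_W ≤ ep² • μ_W`
    rw [hμW, Measure.le_iff]
    intro s hs
    rw [Measure.smul_apply, Measure.smul_apply, smul_eq_mul, smul_eq_mul, withDensity_apply _ hs,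
      ENNReal.ofReal_mul heppos.le]
    have h1 : π s ≤ ENNReal.ofReal ep * ∫⁻ U in s, w U ∂π := by
      calc π s = ∫⁻ _U in s, (1 : ℝ≥0∞) ∂π := by rw [lintegral_const, Measure.restrict_apply_univ, one_mul]
        _ ≤ ∫⁻ U in s, ENNReal.ofReal ep * w U ∂π := by
            refine lintegral_mono fun U => ?_
            calc (1 : ℝ≥0∞) = ENNReal.ofReal ep * ENNReal.ofReal em := by
                  rw [← ENNReal.ofReal_mul heppos.le, hep, hem, ← Real.exp_add, add_neg_cancel, Real.exp_zero,
                    ENNReal.ofReal_one]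
              _ ≤ ENNReal.ofReal ep * w U := mul_le_mul' le_rfl (hw_ge U)
        _ = ENNReal.ofReal ep * ∫⁻ U in s, w U ∂π := by
            rw [lintegral_const_mul' _ _ ENNReal.ofReal_ne_top]
    have h2 : ∫⁻ U in s, w U ∂π = Z * (Z⁻¹ * ∫⁻ U in s, w U ∂π) := by
      rw [← mul_assoc, ENNReal.mul_inv_cancel hZ0 hZtop, one_mul]
    calc π s ≤ ENNReal.ofReal ep * ∫⁻ U in s, w U ∂π := h1
      _ = ENNReal.ofReal ep * (Z * (Z⁻¹ * ∫⁻ U in s, w U ∂π)) := by rw [← h2]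
      _ ≤ ENNReal.ofReal ep * (ENNReal.ofReal ep * (Z⁻¹ * ∫⁻ U in s, w U ∂π)) :=
          mul_le_mul' le_rfl (mul_le_mul' hZup le_rfl)
      _ = ENNReal.ofReal ep * ENNReal.ofReal ep * (Z⁻¹ * ∫⁻ U in s, w U ∂π) := (mul_assoc _ _ _).symm

/-! ## §2 The law at one time `t ≥ 2`, explicit constant -/

/-- ★★ **The law of the SZZ dynamics at a lattice time `t ≥ 2` is dominated by an explicit multiple of product Haar**:
`law(U_t) ≤ e^(48|β'|#E·t + 2|β'|#𝒫) · 2(3/2)^(#E) · Haar^{⊗E}` (every coupling, every solution from a deterministic start on any space).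
[folklore] -/
theorem map_le_smul_haar_explicit (β' : ℝ) {t : ℝ≥0} (ht2 : 2 ≤ (t : ℝ))
    (z : GaugeConfig 3 L (Matrix.specialUnitaryGroup (Fin 2) ℂ))
    {Ω : Type} [MeasurableSpace Ω] {P : Measure Ω} [IsProbabilityMeasure P]
    {W : ℝ≥0 → Ω → (Edge 3 L × NoiseIdx 2 → ℝ)} (hW : IsFlatBrownian W P)
    {U : ℝ≥0 → Ω → GaugeConfig 3 L (Matrix.specialUnitaryGroup (Fin 2) ℂ)} (hU0 : ∀ ω, U 0 ω = z)
    (hU : (latticeLangevinDynamics (fundamentalLatticeRep 2) β').IsSolution (fundamentalRep (Fin 2)) hW.natFiltration P W U) :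
    P.map (U t) ≤ (ENNReal.ofReal (Real.exp ((48 * |β'| * (Fintype.card (Edge 3 L) : ℝ)) * (t : ℝ) + (2 * |β'| * (Fintype.card (Plaquette 3 L) : ℝ))) * (2 * (3 / 2 : ℝ) ^ Fintype.card (Edge 3 L)))) •
      (Measure.pi fun _ : Edge 3 L => haarProbability (Matrix.specialUnitaryGroup (Fin 2) ℂ)) := by
  classical
  haveI := secondCountableTopology_su2
  haveI := borelSpace_config L
  haveI : IsProbabilityMeasure (haarProbability (Matrix.specialUnitaryGroup (Fin 2) ℂ)) := inferInstance
  haveI := isProbabilityMeasure_piWiener (Edge 3 L × NoiseIdx 2)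
  have hWc := isFlatBrownian_piWiener 3 L (NoiseIdx 2)
  obtain ⟨X, GX, hX, hXm, -, -, -⟩ := exists_regularFlow L β' hWc
  obtain ⟨Y, GY, hY, hYm, -, -, -⟩ := exists_regularFlow L 0 hWc
  have hlaw : P.map (U t) = (Measure.pi fun _ : Edge 3 L × NoiseIdx 2 => preWienerMeasure).map (X z t) :=
    lawUnique_of_start β' z hW hWc hU0 hU (fun ω => (hX z).1 ω) (hX z).2 t
  rw [hlaw]
  have hmX : Measurable (X z t) := ((hX z).2.adapted t).mono (hWc.natFiltration.le t) le_rfl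
  have hmY : Measurable (Y z t) := ((hY z).2.adapted t).mono (hWc.natFiltration.le t) le_rfl
  set lawX := (Measure.pi fun _ : Edge 3 L × NoiseIdx 2 => preWienerMeasure).map (X z t) with hlawX
  set lawY := (Measure.pi fun _ : Edge 3 L × NoiseIdx 2 => preWienerMeasure).map (Y z t) with hlawY
  haveI : IsProbabilityMeasure lawX := Measure.isProbabilityMeasure_map hmX.aemeasurable
  haveI : IsProbabilityMeasure lawY := Measure.isProbabilityMeasure_map hmY.aemeasurable
  have hcmp := integral_le_exp_mul_integral_beta_zero_explicit (L := L) β' hWc X hX hXm hWc Y hY hYm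
  set c : ℝ := Real.exp ((48 * |β'| * (Fintype.card (Edge 3 L) : ℝ)) * (t : ℝ) + (2 * |β'| * (Fintype.card (Plaquette 3 L) : ℝ))) with hc
  haveI : IsFiniteMeasure ((ENNReal.ofReal c) • lawY) :=
    ⟨by rw [Measure.smul_apply, smul_eq_mul]; exact ENNReal.mul_lt_top ENNReal.ofReal_lt_top (measure_lt_top _ _)⟩
  have hle : lawX ≤ (ENNReal.ofReal c) • lawY := by
    refine measure_le_of_forall_integral_le fun f hf hf0 hf1 => ?_
    rw [integral_smul_measure, ENNReal.toReal_ofReal (Real.exp_pos _).le, smul_eq_mul, hlawX, hlawY,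
      integral_map hmX.aemeasurable hf.aestronglyMeasurable, integral_map hmY.aemeasurable hf.aestronglyMeasurable]
    exact hcmp f hf hf0 hf1 z t
  have hYle := map_le_smul_haar_beta_zero_explicit (L := L) ht2 z hWc (fun ω => (hY z).1 ω) (hY z).2
  set C : ℝ := (2 * (3 / 2 : ℝ) ^ Fintype.card (Edge 3 L)) with hCdef
  have hC0 : 0 ≤ C := by positivity
  rw [ENNReal.ofReal_mul (Real.exp_pos _).le]
  refine hle.trans (Measure.le_iff'.2 fun A => ?_)
  have h1 := Measure.le_iff'.1 hYle A
  simp only [Measure.smul_apply, smul_eq_mul] at h1 ⊢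
  calc ENNReal.ofReal c * lawY A ≤ ENNReal.ofReal c * (ENNReal.ofReal C *
      (Measure.pi fun _ : Edge 3 L => haarProbability (Matrix.specialUnitaryGroup (Fin 2) ℂ)) A) := mul_le_mul' le_rfl h1
    _ = _ := (mul_assoc _ _ _).symm

/-! ## §3 Uniformity in time, explicit constant -/

/-- ★★★ **Uniform-in-time density bound with an explicit constant**: for every coupling `β'`, start `z`, lattice time `t₁ ≥ 2`, EVERY
solution from `z` on ANY space and ALL `s ≥ 0`:
`law(U_(t₁+s)) ≤ e^(48|β'|#E·t₁ + 2|β'|#𝒫) · 2(3/2)^(#E) · a² · Haar^{⊗E}`, `a = e^(4|β'|#𝒫)²` — `log` of the constant is linear in `L³`.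
[cite: ShenZhuZhu2022, §3 Lemma 3.3 (p. 13)] [folklore] -/
theorem map_le_smul_haar_of_le_explicit (β' : ℝ) {t₁ : ℝ≥0} (ht₁ : 2 ≤ (t₁ : ℝ))
    (z : GaugeConfig 3 L (Matrix.specialUnitaryGroup (Fin 2) ℂ)) :
    ∀ {Ω : Type} [MeasurableSpace Ω] {P : Measure Ω} [IsProbabilityMeasure P]
      {W : ℝ≥0 → Ω → (Edge 3 L × NoiseIdx 2 → ℝ)} (hW : IsFlatBrownian W P)
      {U : ℝ≥0 → Ω → GaugeConfig 3 L (Matrix.specialUnitaryGroup (Fin 2) ℂ)}, (∀ ω, U 0 ω = z) →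
      (latticeLangevinDynamics (fundamentalLatticeRep 2) β').IsSolution (fundamentalRep (Fin 2)) hW.natFiltration P W U →
      ∀ s : ℝ≥0, P.map (U (t₁ + s)) ≤ (ENNReal.ofReal ((Real.exp ((48 * |β'| * (Fintype.card (Edge 3 L) : ℝ)) * (t₁ : ℝ) + (2 * |β'| * (Fintype.card (Plaquette 3 L) : ℝ))) * (2 * (3 / 2 : ℝ) ^ Fintype.card (Edge 3 L))) * ((Real.exp (|β'| * (4 * (Fintype.card (Plaquette 3 L) : ℝ))) * Real.exp (|β'| * (4 * (Fintype.card (Plaquette 3 L) : ℝ)))) * (Real.exp (|β'| * (4 * (Fintype.card (Plaquette 3 L) : ℝ))) * Real.exp (|β'| * (4 * (Fintype.card (Plaquette 3 L) : ℝ))))))) •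
        (Measure.pi fun _ : Edge 3 L => haarProbability (Matrix.specialUnitaryGroup (Fin 2) ℂ)) := by
  classical
  haveI := secondCountableTopology_su2
  haveI := borelSpace_config L
  -- THE kernels; Wilson invariance in kernel form; Wilson/Haar comparison
  obtain ⟨κ, hκM, -, hreal⟩ := exists_transitionKernel L β'
  haveI := hκM
  have hinv : ∀ t, Kernel.Invariant (κ t) (wilsonMeasure (d := 3) (L := L) (fundamentalRep (Fin 2)) β') :=
    (wilsonMeasureLangevinInvariant_iff_kernelInvariant (L := L) β' κ hreal).mp (wilsonMeasureLangevinInvariant_su2 L β')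
  obtain ⟨hWle, hπle⟩ := wilsonMeasure_le_smul_pi_haar_and_explicit (L := L) β'
  obtain ⟨a, hadef⟩ : ∃ a : ℝ, (Real.exp (|β'| * (4 * (Fintype.card (Plaquette 3 L) : ℝ))) * Real.exp (|β'| * (4 * (Fintype.card (Plaquette 3 L) : ℝ)))) = a := ⟨_, rfl⟩
  have ha : 0 < a := by rw [← hadef]; positivity
  rw [hadef] at hWle hπle ⊢
  -- the regular flow on the product Wiener space realises every law; bound at time `t₁`
  haveI := isProbabilityMeasure_piWiener (Edge 3 L × NoiseIdx 2)
  have hWc := isFlatBrownian_piWiener 3 L (NoiseIdx 2)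
  obtain ⟨X, -, hX, -, -, -, -⟩ := exists_regularFlow L β' hWc
  have hle₁ := map_le_smul_haar_explicit (L := L) β' ht₁ z hWc (fun ω => (hX z).1 ω) (hX z).2
  obtain ⟨C₁, hC₁def⟩ : ∃ C₁ : ℝ, (Real.exp ((48 * |β'| * (Fintype.card (Edge 3 L) : ℝ)) * (t₁ : ℝ) + (2 * |β'| * (Fintype.card (Plaquette 3 L) : ℝ))) * (2 * (3 / 2 : ℝ) ^ Fintype.card (Edge 3 L))) = C₁ := ⟨_, rfl⟩
  have hC₁ : 0 ≤ C₁ := by rw [← hC₁def]; positivity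
  rw [hC₁def] at hle₁ ⊢
  intro Ω mΩ P hP W hW U hU0 hU s
  -- law at `t₁ + s` through the kernels: `κ_{t₁+s}(z) = (κ_{t₁} z).bind κ_s`
  have hlaw : P.map (U (t₁ + s)) = (κ t₁ z).bind (κ s) := by
    rw [← hreal (t₁ + s) z Ω P W hW U hU0 hU, chapmanKolmogorov_szz β' κ hreal t₁ s, Kernel.comp_apply]
  have hκt₁ : κ t₁ z ≤ (ENNReal.ofReal C₁) •
      (Measure.pi fun _ : Edge 3 L => haarProbability (Matrix.specialUnitaryGroup (Fin 2) ℂ)) := by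
    rw [hreal t₁ z _ _ _ hWc (X z) (hX z).1 (hX z).2]
    exact hle₁
  rw [hlaw, ENNReal.ofReal_mul hC₁, ENNReal.ofReal_mul ha.le]
  -- `(κ t₁ z).bind κ_s ≤ C₁ • π.bind κ_s ≤ C₁ a • μ_W.bind κ_s = C₁ a • μ_W ≤ C₁ a² • π`
  have h1 := bind_le_smul_bind (κ s) hκt₁
  have h2 := bind_le_smul_bind (κ s) hπle
  have h3 : (wilsonMeasure (d := 3) (L := L) (fundamentalRep (Fin 2)) β').bind (κ s) =
      wilsonMeasure (d := 3) (L := L) (fundamentalRep (Fin 2)) β' := hinv s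
  rw [h3] at h2
  rw [Measure.le_iff]
  intro A hA
  have e1 := Measure.le_iff.1 h1 A hA
  have e2 := Measure.le_iff.1 h2 A hA
  have e3 := Measure.le_iff.1 hWle A hA
  simp only [Measure.smul_apply, smul_eq_mul] at e1 e2 e3 ⊢
  calc ((κ t₁ z).bind (κ s)) A
      ≤ ENNReal.ofReal C₁ * ((Measure.pi fun _ : Edge 3 L =>
          haarProbability (Matrix.specialUnitaryGroup (Fin 2) ℂ)).bind (κ s)) A := e1
    _ ≤ ENNReal.ofReal C₁ * (ENNReal.ofReal a * (wilsonMeasure (d := 3) (L := L) (fundamentalRep (Fin 2)) β') A) :=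
        mul_le_mul' le_rfl e2
    _ ≤ ENNReal.ofReal C₁ * (ENNReal.ofReal a * (ENNReal.ofReal a *
          (Measure.pi fun _ : Edge 3 L => haarProbability (Matrix.specialUnitaryGroup (Fin 2) ℂ)) A)) :=
        mul_le_mul' le_rfl (mul_le_mul' le_rfl e3)
    _ = ENNReal.ofReal C₁ * (ENNReal.ofReal a * ENNReal.ofReal a) *
          (Measure.pi fun _ : Edge 3 L => haarProbability (Matrix.specialUnitaryGroup (Fin 2) ℂ)) A := by ring

end Summit.QuantumFields.YangMills.Theorems.ColdStartUniversality
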